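import Summits.Ventures.HodgeRepro2.T6A2WeilShadow

/-!
# T6A2WeilLef — the algebraic classes of the model are the host's, and the Lefschetz (1,1) binder on the host

Cell pub-hodge-repro2, Tier 6 (README §10), seat t6-p2 (A2 host side; continues T6A2WeilShadow). The one
`Prop` binder of `transferShadowWeil` beyond the host's named Props and the Lange display is `hLef`, the
Lefschetz (1,1) statement in the MODEL's words (`∀ a ∈ degB K 2, extC K a ∈ hodge F 1 1 → a ∈ Alg 1`). This
file splits it into its two host-side halves:
* **the algebraic classes of the model are the host's**: `evOf_ofDeg_mem_algOf` (`ev (ofDeg p c) ∈ Alg p` for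
  `c ∈ ratAlgebraicClasses B p`) and its converse `exists_of_mem_algOf` (an element of `Alg p` is `ev (ofDeg p c)`
  for an algebraic `c`), with `mem_algOf_iff`; `algebraicClasses_eq_ratAlgebraicClasses` (`ℚ`-coefficients:
  the host's `algebraicClasses` IS `ratAlgebraicClasses`);
* **`hLef_of`**: `hLef` follows from (i) a Lefschetz (1,1) statement ON THE HOST, `hLefW : hodge11W ≤
  W.ratAlgebraicClasses B 1` for a submodule `hodge11W ⊆ H²(B)` (the `(1,1)`-classes of the host's Hodge
  structure — the display clause of Voisin I Thm 11.30 + Cor. 11.34 on the host, owner t6-p2 / lead's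
  existential host display), and (ii) the A1-side identification of the Hodge types, `hHodge : ∀ a ∈ degB K 2,
  extC K a ∈ hodge F 1 1 → (evF⁻¹ a)₂ ∈ hodge11W` (the CM-type ↔ Hodge-type dictionary, owner t6-p1).
No `sorry`; standard axioms. §8(d): uses an L-value-free non-vanishing device: NO.
-/

noncomputable section

namespace Summit.Ventures.HodgeRepro2.T6.WeilInst

open HostAPI.Carriers.AlgebraicGeometry.Motives CategoryTheory Opposite
open Summit.Ventures.HodgeRepro2.T6 Summit.Ventures.HodgeRepro2.T6.A2Gysin
  Summit.Ventures.HodgeRepro2.T6.A2Shadow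
open scoped DirectSum

universe u

variable {k : Type u} [Field k] (W : WeilCohomology k ℚ)

section ratAlg

variable (P : SPVar k)

/-- `ratAlgebraicClasses` is closed under rational scalars (`N · den(r)` clears the denominator) -/
theorem smul_mem_ratAlgebraicClasses (p : ℕ) (r : ℚ) {y : W.obj P.X (2 * p)}
    (hy : y ∈ W.ratAlgebraicClasses P.X p) : r • y ∈ W.ratAlgebraicClasses P.X p := by
  obtain ⟨N, hN, hNy⟩ := hy
  refine ⟨N * r.den, mul_ne_zero hN (by exact_mod_cast r.den_ne_zero), ?_⟩
  have : (N * (r.den : ℤ)) • (r • y) = (r.num : ℤ) • (N • y) := by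
    rw [← Int.cast_smul_eq_zsmul ℚ, ← Int.cast_smul_eq_zsmul ℚ (r.num), ← Int.cast_smul_eq_zsmul ℚ N,
      smul_smul, smul_smul]
    congr 1
    push_cast
    rw [mul_assoc, mul_comm (r.den : ℚ) r, Rat.mul_den_eq_num, mul_comm]
  rw [this]
  exact AddSubgroup.zsmul_mem _ hNy _

/-- with `ℚ`-coefficients the host's `algebraicClasses` (the `ℚ`-span of the cycle classes) is
`ratAlgebraicClasses` (the classes with an integer multiple in the lattice) -/
theorem mem_algebraicClasses_iff (p : ℕ) (x : W.obj P.X (2 * p)) :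
    x ∈ W.algebraicClasses P.X p ↔ x ∈ W.ratAlgebraicClasses P.X p := by
  constructor
  · intro hx
    refine Submodule.span_induction (p := fun x _ => x ∈ W.ratAlgebraicClasses P.X p) ?_ ?_ ?_ ?_ hx
    · intro y hy; exact W.algebraicLattice_le_ratAlgebraicClasses P.X p hy
    · exact zero_mem _
    · intro y z _ _ hy hz; exact add_mem hy hz
    · intro r y _ hy
      exact smul_mem_ratAlgebraicClasses W P p r hy
  · intro hx
    exact W.ratAlgebraicClasses_le_algebraicClasses P.X p hx

end ratAlg

section alg

variable {K : Type*} [Field K] [NumberField K] (D : SituationData k) (hgen : D.HasGens) (hten : D.ProductsSmooth)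
  (A : OrderAction W D.B K) (hL : Function.Bijective (langeMap W D.B))

/-- the model's algebraic classes of codimension `p` are the images of the host's: an algebraic `c` gives
`ev (ofDeg p c) ∈ Alg p` -/
theorem evOf_ofDeg_mem_algOf {p : ℕ} {c : Ev W D.B.X p} (hc : c ∈ W.ratAlgebraicClasses D.B.X p) :
    evOf W D A hL (ofDeg W D.B p c) ∈ (identB W D hgen hten A hL).algOf p := by
  refine ⟨Submodule.subset_span ⟨ofDeg W D.B p c, ?_, rfl⟩, ?_⟩
  · -- `ofDeg p c ∈ 𝒞.Alg B`: the range of the inclusion of `algSub`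
    exact ⟨⟨ofDeg W D.B p c, ofDeg_mem_algSub W D.B (hgen ⟨1⟩) hc⟩, rfl⟩
  · rw [evOf_eq_evF, evenToFull_ofDeg]
    exact evF_ofDegF_mem_degB W D A hL _ _

/-- conversely, an element of `Alg p` is `ev (ofDeg p c)` for an algebraic `c` (the degree-`p` component of
any algebraic pre-image; `algSub` is spanned by homogeneous algebraic classes) -/
theorem exists_of_mem_algOf {p : ℕ} {a : HB K} (ha : a ∈ (identB W D hgen hten A hL).algOf p) :
    ∃ c ∈ W.ratAlgebraicClasses D.B.X p, a = evOf W D A hL (ofDeg W D.B p c) := by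
  obtain ⟨a', ha', rfl⟩ := IdentBB.exists_mem_Alg_of_mem_span (I := identB W D hgen hten A hL) ha.1
  rw [identB_ev] at ha ⊢
  obtain ⟨c, rfl⟩ := exists_eq_ofDeg_of_evOf_mem W D A hL ha.2
  refine ⟨c, ?_, rfl⟩
  -- `a' = ofDeg p c ∈ algSub`; its degree-`p` component is a rational algebraic class
  obtain ⟨⟨x, hx⟩, hxa⟩ := ha'
  change (x : EvenRing W D.B) = ofDeg W D.B p c at hxa
  have hx' : ofDeg W D.B p c ∈ Submodule.span ℚ (algSet W D.B) := hxa ▸ hx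
  have hcomp : ∀ y ∈ Submodule.span ℚ (algSet W D.B), y p ∈ W.ratAlgebraicClasses D.B.X p := by
    intro y hy
    refine Submodule.span_induction (p := fun y _ => y p ∈ W.ratAlgebraicClasses D.B.X p) ?_ ?_ ?_ ?_ hy
    · intro z hz
      obtain ⟨q, b, hb, rfl⟩ := Set.mem_iUnion.1 hz
      by_cases hq : q = p
      · subst hq
        rw [ofDeg, DirectSum.lof_eq_of, DirectSum.of_eq_same]
        exact hb
      · rw [ofDeg_apply_of_ne W D.B (Ne.symm hq)]
        exact zero_mem _
    · simp only [DirectSum.zero_apply]; exact zero_mem _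
    · intro y z _ _ hy hz
      rw [DirectSum.add_apply]; exact add_mem hy hz
    · intro r y _ hy
      rw [DirectSum.smul_apply]
      exact smul_mem_ratAlgebraicClasses W D.B p r hy
  have := hcomp _ hx'
  rwa [ofDeg, DirectSum.lof_eq_of, DirectSum.of_eq_same] at this

/-- THE LEFSCHETZ (1,1) BINDER OF `transferShadowWeil` FROM ITS TWO HOST-SIDE HALVES: a Lefschetz (1,1)
statement on the host (`hodge11W ≤ ratAlgebraicClasses B 1`, the `(1,1)`-classes of `H²(B)` are algebraic)
and the identification of the model's `(1,1)`-type with the host's (`hHodge`, A1's dictionary). -/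
theorem hLef_of (F : FaceSetting K) (hodge11W : Submodule ℚ (W.obj D.B.X 2))
    (hLefW : ∀ c ∈ hodge11W, c ∈ W.ratAlgebraicClasses D.B.X 1)
    (hHodge : ∀ a ∈ degB K 2, extC K a ∈ hodge F 1 1 → ((evF W D A hL).symm a) 2 ∈ hodge11W) :
    ∀ a ∈ degB K 2, extC K a ∈ hodge F 1 1 → a ∈ (identB W D hgen hten A hL).algOf 1 := by
  intro a ha hH
  obtain ⟨c, hc⟩ := evF_symm_mem_range_ofDegF W D A hL ha
  have hc2 : ((evF W D A hL).symm a) 2 = c := by rw [← hc, ofDegF_apply_same]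
  have hcalg : c ∈ W.ratAlgebraicClasses D.B.X 1 := hc2 ▸ hLefW _ (hHodge a ha hH)
  have := evOf_ofDeg_mem_algOf W D hgen hten A hL hcalg
  rwa [evOf_eq_evF, evenToFull_ofDeg, hc, AlgEquiv.apply_symm_apply] at this

end alg

end Summit.Ventures.HodgeRepro2.T6.WeilInst

end
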